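import Literature.NumberTheory.Rogawski1990.KottwitzSignCM
import Literature.NumberTheory.Automorphic.UnitaryGroupSplitPlace
import HarnessLib

/-!
# Kottwitz signs, III: readings — the sign at the killing pair over a domain, and split places (`e_v ≡ 1`)
# (Rogawski 1990, §4.1 (4.1.2) pp. 39–40; §3.8 Prop. 3.8.1 p. 30; §8.2 p. 117)

Topic `NumberTheory/Rogawski1990`; namespace `Literature.NumberTheory.Rogawski1990`.  THEOREMS ONLY (no definition, no named fact, no instance,
no notation, no `sorry`).  Cell `pub/hodgecm-mathlib`, ENGINE T1 (crux H413 = `stmt-HodgeConjecture-24833`), row O7 «singular semisimple classes»,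
«KOTTWITZ SIGNS» (F0P3a-plan RULING #116 (W19-1), O7 OWNER WORD #24 (B) ∕ #26 (1)(a)): the first READINGS of ★ `kottwitzSign` (★ `KottwitzSign`,
★ `KottwitzSignCM`).  HC_CM is proved only modulo the printed citations until rung 0 closes; this file discharges none of them.

## What is proved

* §1 (any commutative ring): `hasIsotropicEigenvector_comm`; over a DOMAIN the killing pair of a split-singular `X` is unique up to order
  (`IsSplitSingular.pair_eq`), hence **`kottwitzSign_eq_neg_one_iff_not_hasIsotropicEigenvector`**: `e(X) = −1 ↔` the `(a,b)`-eigenvectors of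
  `X` carry no isotropic vector — the sign is READ at the one pair that kills `X`.
* §2 SPLIT-TYPE RINGS: `exists_eigenvector_of_isSplitSingular` (a split-singular matrix has a non-zero eigenvector for `a` or `b` over any
  ring); if the ring has an element `ε` with `σ(ε)·ε = 0 = σ(1−ε)·(1−ε)` (the indicator of one factor of `E ⊗_F F_v = E_w × E_{w̄}` at a SPLIT
  place), then `ε v` or `(1−ε) v` is a non-zero ISOTROPIC eigenvector, so **`kottwitzSign_eq_one_of_conj_mul_self_eq_zero`: `e ≡ 1`** there —
  the unitary group at a split place is `GL₃`, every centraliser quasi-split.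
* §3 CM reading at a SPLIT finite place `v` of `L⁺` (`c • w ≠ w` for a place `w ∣ v` of `L`): **`kottwitzSignLocal_eq_one_of_smul_ne`** —
  `e_v ≡ 1` on `ConjClasses U(H)(L⁺_v)` (the idempotent `ε = 1_w ∈ L ⊗ L⁺_v = L_w × L_{c⁻¹w}`, ★ `PlacesOver.eq_or_eq_galInv`).
Sequels: `KottwitzSignDiagonalModel` (the diagonal model `diag(a,a,b)` ∕ `diag(t₀,t₁,t₂)` to which ★ `kottwitzSign_congr` reduces every framed
split-singular element), `KottwitzSignProductFormula` (the finite non-split and real readings through ★ `LemD1OfPlace.standingData` ∕ Hilbert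
symbols, and W19-4 `kottwitzSignAdelic (toAdelic γ₀) = 1` by Hilbert reciprocity, ★ `even_ncard_not_isIsotropic_add_ncard_pos`).

## References
* [Rogawski1990] J. D. Rogawski, *Automorphic Representations of Unitary Groups in Three Variables*, Ann. of Math. Stud. 123 (1990), §4.1 (4.1.2)
  pp. 39–40; §3.8 Prop. 3.8.1 p. 30; §8.2 p. 117.
* [Kottwitz1983] R. E. Kottwitz, *Sign changes in harmonic analysis on reductive groups*, Trans. AMS 278 (1983), 289–297.
* [CasselsFrohlichANT1967] Cassels–Fröhlich (eds.), *Algebraic Number Theory* (1967), Ch. VII Prop. 1.2 (ii) (places above `v`), Ch. II §10.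
-/

set_option autoImplicit false

noncomputable section

open NumberField IsDedekindDomain Matrix
open scoped MatrixGroups

namespace Literature.NumberTheory.Rogawski1990

open Literature.NumberTheory.Automorphic
open Literature.AlgebraicGeometry.ShimuraVarieties (hermForm)

/-! ## §1 The sign is read at the killing pair -/

section Generic

variable {R : Type*} [CommRing R] {n : Type*} [Fintype n] [DecidableEq n] {σ : R →+* R} {H : Matrix n n R}

omit [DecidableEq n] in
/-- `HasIsotropicEigenvector` is symmetric in the pair. [cite: Rogawski1990, §3.8 p. 30] -/
theorem hasIsotropicEigenvector_comm {X : Matrix n n R} {a b : R} :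
    HasIsotropicEigenvector σ H X a b ↔ HasIsotropicEigenvector σ H X b a :=
  exists_congr fun _ => and_congr Iff.rfl (and_congr Or.comm Iff.rfl)

/-- Expansion of the killing relation: `(X − a)(X − b) = 0` means `X² = (a + b) X − ab`. [cite: Rogawski1990, §3.8 p. 30] -/
theorem mul_self_eq_of_isSplitSingular {X : Matrix n n R} {a b : R} (h : IsSplitSingular X a b) :
    X * X = (a + b) • X - (a * b) • (1 : Matrix n n R) := by
  have h1 : (X - a • (1 : Matrix n n R)) * (X - b • (1 : Matrix n n R)) = X * X - (a + b) • X + (a * b) • (1 : Matrix n n R) := by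
    rw [Matrix.mul_sub, Matrix.sub_mul, Matrix.sub_mul, Matrix.mul_smul, Matrix.mul_one, Matrix.smul_mul, Matrix.one_mul,
      Matrix.smul_mul, Matrix.one_mul, smul_smul, add_smul]
    abel
  have h2 := h.2.1
  rw [h1] at h2
  rw [← sub_eq_zero, ← h2]
  abel

end Generic

section Domain

variable {K : Type*} [CommRing K] [IsDomain K] {n : Type*} [Fintype n] [DecidableEq n] [Nonempty n] {σ : K →+* K} {H : Matrix n n K}

/-- **Over a domain the killing pair of a split-singular matrix is unique up to order**: if `(X − a)(X − b) = 0 = (X − a′)(X − b′)` with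
`a − b`, `a′ − b′` units and `X` not one of the four scalars, then `{a′, b′} = {a, b}` (else `(a′+b′−a−b) X = (a′b′ − ab)·1` makes `X` scalar,
which ★ `not_isSplitSingular_smul_one` forbids). [cite: Rogawski1990, §3.8 Prop. 3.8.1 p. 30] -/
theorem IsSplitSingular.pair_eq {X : Matrix n n K} {a b a' b' : K} (h : IsSplitSingular X a b) (h' : IsSplitSingular X a' b') :
    (a' = a ∧ b' = b) ∨ (a' = b ∧ b' = a) := by
  have e1 := mul_self_eq_of_isSplitSingular h
  have e2 := mul_self_eq_of_isSplitSingular h'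
  have key : (a' + b' - (a + b)) • X = (a' * b' - a * b) • (1 : Matrix n n K) := by
    rw [sub_smul, sub_smul]
    have h3 : (a' + b') • X = X * X + (a' * b') • (1 : Matrix n n K) := by rw [e2]; abel
    have h4 : (a + b) • X = X * X + (a * b) • (1 : Matrix n n K) := by rw [e1]; abel
    rw [h3, h4]
    abel
  obtain ⟨i₀⟩ := ‹Nonempty n›
  by_cases hs : a' + b' - (a + b) = 0
  · have hsum : a' + b' = a + b := sub_eq_zero.1 hs
    have hprod : a' * b' = a * b := by
      rw [hs, zero_smul] at key
      have h5 := congrFun (congrFun key i₀) i₀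
      simp only [Matrix.zero_apply, Matrix.smul_apply, Matrix.one_apply_eq, smul_eq_mul, mul_one] at h5
      exact (sub_eq_zero.1 h5.symm)
    have hroot : (a' - a) * (a' - b) = 0 := by
      have h6 : (a' - a) * (a' - b) = a' * a' - (a + b) * a' + a * b := by ring
      rw [h6, ← hsum, ← hprod]
      ring
    rcases mul_eq_zero.1 hroot with h7 | h7
    · left
      refine ⟨sub_eq_zero.1 h7, ?_⟩
      rw [sub_eq_zero.1 h7] at hsum
      exact add_left_cancel hsum
    · right
      refine ⟨sub_eq_zero.1 h7, ?_⟩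
      rw [sub_eq_zero.1 h7] at hsum
      linear_combination hsum
  · exfalso
    have hentry : ∀ i j, (a' + b' - (a + b)) * X i j = (a' * b' - a * b) * (if i = j then 1 else 0) := fun i j => by
      have h5 := congrFun (congrFun key i) j
      simpa only [Matrix.smul_apply, Matrix.one_apply, smul_eq_mul] using h5
    have hX : X = X i₀ i₀ • (1 : Matrix n n K) := by
      ext i j
      by_cases hij : i = j
      · subst hij
        simp only [Matrix.smul_apply, Matrix.one_apply_eq, smul_eq_mul, mul_one]
        have h8 := hentry i i
        have h9 := hentry i₀ i₀
        simp only [if_true, mul_one] at h8 h9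
        exact mul_left_cancel₀ hs (h8.trans h9.symm)
      · simp only [Matrix.smul_apply, Matrix.one_apply_ne hij, smul_eq_mul, mul_zero]
        have h8 := hentry i j
        simp only [if_neg hij, mul_zero] at h8
        exact (mul_eq_zero.1 h8).resolve_left hs
    rw [hX] at h
    exact not_isSplitSingular_smul_one (X i₀ i₀) a b h

/-- **THE SIGN IS READ AT THE KILLING PAIR** (domain): for `X` split-singular with respect to `(a, b)`,
`e(X) = −1 ↔` there is NO non-zero isotropic eigenvector for `a` or `b`. [cite: Rogawski1990, §4.1 (4.1.2) p. 39; §8.2 p. 117] -/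
theorem kottwitzSign_eq_neg_one_iff_not_hasIsotropicEigenvector {X : Matrix n n K} {a b : K} (h : IsSplitSingular X a b) :
    kottwitzSign σ H X = -1 ↔ ¬ HasIsotropicEigenvector σ H X a b := by
  rw [kottwitzSign_eq_neg_one_iff]
  constructor
  · rintro ⟨a', b', h', hn⟩
    rcases h.pair_eq h' with ⟨rfl, rfl⟩ | ⟨rfl, rfl⟩
    · exact hn
    · exact fun hab => hn (hasIsotropicEigenvector_comm.1 hab)
  · exact fun hn => ⟨a, b, h, hn⟩

/-- Dually: `e(X) = 1 ↔` some `(a,b)`-eigenvector of `X` is isotropic. [cite: Rogawski1990, §4.1 (4.1.2) p. 39; §8.2 p. 117] -/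
theorem kottwitzSign_eq_one_iff_hasIsotropicEigenvector {X : Matrix n n K} {a b : K} (h : IsSplitSingular X a b) :
    kottwitzSign σ H X = 1 ↔ HasIsotropicEigenvector σ H X a b := by
  rcases kottwitzSign_eq_one_or_eq_neg_one (σ := σ) (H := H) X with h1 | h1
  · refine ⟨fun _ => ?_, fun _ => h1⟩
    by_contra hn
    have h2 := (kottwitzSign_eq_neg_one_iff_not_hasIsotropicEigenvector (σ := σ) (H := H) h).2 hn
    rw [h1] at h2
    exact absurd (congrArg Units.val h2) (by decide)
  · refine ⟨fun h2 => ?_, fun hh => ?_⟩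
    · rw [h1] at h2
      exact absurd (congrArg Units.val h2) (by decide)
    · exact absurd hh ((kottwitzSign_eq_neg_one_iff_not_hasIsotropicEigenvector (σ := σ) (H := H) h).1 h1)

end Domain

/-! ## §2 Split-type rings: an idempotent with `σ(ε) ε = 0 = σ(1−ε)(1−ε)` makes every sign `1` -/

section SplitType

variable {R : Type*} [CommRing R] {n : Type*} [Fintype n] [DecidableEq n] [Nonempty n] (σ : R →+* R) (H : Matrix n n R)

/-- A split-singular matrix has a NON-ZERO eigenvector for `a` or for `b` (over any commutative ring): for `y = e_{i₀}`, either
`(X − b) y ≠ 0` is an `a`-eigenvector (as `(X − a)(X − b) y = 0`) or `y` itself is a `b`-eigenvector. [cite: Rogawski1990, §3.8 p. 30] -/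
theorem exists_eigenvector_of_isSplitSingular {X : Matrix n n R} {a b : R} (h : IsSplitSingular X a b) :
    ∃ v : n → R, v ≠ 0 ∧ (X *ᵥ v = a • v ∨ X *ᵥ v = b • v) := by
  obtain ⟨i₀⟩ := ‹Nonempty n›
  -- the ring is non-trivial (else `X = a • 1`)
  have h10 : (1 : R) ≠ 0 := by
    intro h10
    haveI := subsingleton_of_zero_eq_one h10.symm
    exact h.2.2.1 (Subsingleton.elim _ _)
  set y : n → R := Pi.single i₀ 1 with hy
  have hy0 : y ≠ 0 := by
    intro h0
    have h1 := congrFun h0 i₀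
    rw [hy, Pi.single_eq_same] at h1
    exact h10 h1
  by_cases hu : (X - b • (1 : Matrix n n R)) *ᵥ y = 0
  · refine ⟨y, hy0, Or.inr ?_⟩
    rwa [Matrix.sub_mulVec, sub_eq_zero, Matrix.smul_mulVec, Matrix.one_mulVec] at hu
  · refine ⟨(X - b • (1 : Matrix n n R)) *ᵥ y, hu, Or.inl ?_⟩
    have h0 : (X - a • (1 : Matrix n n R)) *ᵥ ((X - b • (1 : Matrix n n R)) *ᵥ y) = 0 := by
      rw [Matrix.mulVec_mulVec, h.2.1, Matrix.zero_mulVec]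
    rwa [Matrix.sub_mulVec, sub_eq_zero, Matrix.smul_mulVec, Matrix.one_mulVec] at h0

omit [DecidableEq n] [Nonempty n] in
/-- Scaling a vector by `e` scales `⟨v, v⟩_H` by `σ(e) e`. [cite: Rogawski1990, §1.9 p. 11] -/
theorem hermForm_smul_smul (e : R) (v : n → R) : hermForm σ H (e • v) (e • v) = σ e * e * hermForm σ H v v := by
  have hc : (⇑σ ∘ (e • v)) = σ e • (⇑σ ∘ v) := funext fun i => by
    simp only [Function.comp_apply, Pi.smul_apply, smul_eq_mul, map_mul]
  simp only [hermForm, Matrix.mulVec_smul, dotProduct_smul, hc, smul_dotProduct, smul_eq_mul]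
  ring

/-- **An idempotent `ε` with `σ(ε)·ε = 0 = σ(1−ε)·(1−ε)` produces isotropic eigenvectors**: for a non-zero eigenvector `v`, one of
`ε v`, `(1 − ε) v` is a non-zero eigenvector of length `σ(ε)ε⟨v,v⟩ = 0` resp. `σ(1−ε)(1−ε)⟨v,v⟩ = 0`.  (At a split place
`E ⊗_F F_v = E_w × E_{w̄}` with `σ` swapping the factors, `ε = (1, 0)`.) [cite: Rogawski1990, §4.1 (4.1.2) p. 39] [cite: CasselsFrohlichANT1967, Ch. II §10] -/
theorem hasIsotropicEigenvector_of_conj_mul_self_eq_zero {ε : R} (h1 : σ ε * ε = 0) (h2 : σ (1 - ε) * (1 - ε) = 0)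
    {X : Matrix n n R} {a b : R} (h : IsSplitSingular X a b) : HasIsotropicEigenvector σ H X a b := by
  obtain ⟨v, hv, hev⟩ := exists_eigenvector_of_isSplitSingular h
  have hsplit : ε • v + (1 - ε) • v = v := by rw [← add_smul, add_sub_cancel, one_smul]
  have key : ∀ e : R, σ e * e = 0 → e • v ≠ 0 → HasIsotropicEigenvector σ H X a b := by
    intro e he hne
    refine ⟨e • v, hne, ?_, ?_⟩
    · rcases hev with hev | hev
      · left; rw [Matrix.mulVec_smul, hev, smul_comm]
      · right; rw [Matrix.mulVec_smul, hev, smul_comm]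
    · rw [hermForm_smul_smul, he, zero_mul]
  by_cases hε : ε • v = 0
  · have hne : (1 - ε) • v ≠ 0 := by
      intro h0
      apply hv
      rw [← hsplit, hε, h0, add_zero]
    exact key (1 - ε) h2 hne
  · exact key ε h1 hε

/-- **Hence `e ≡ 1` over a split-type ring.** [cite: Rogawski1990, §4.1 (4.1.2) p. 39] -/
theorem kottwitzSign_eq_one_of_conj_mul_self_eq_zero {ε : R} (h1 : σ ε * ε = 0) (h2 : σ (1 - ε) * (1 - ε) = 0) (X : Matrix n n R) :
    kottwitzSign σ H X = 1 :=
  kottwitzSign_eq_one_of_hasIsotropicEigenvector fun _ _ hs => hasIsotropicEigenvector_of_conj_mul_self_eq_zero σ H h1 h2 hs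

end SplitType

/-! ## §3 CM: at a SPLIT finite place every local Kottwitz sign is `1` -/

section CMSplit

variable (L : Type) [Field L] [NumberField L] [IsCMField L] (N : ℕ) [NeZero N] (H : Matrix (Fin N) (Fin N) L)

/-- **At a split place `v` of `L⁺` (a place `w ∣ v` of `L` with `c • w ≠ w`) `e_v ≡ 1`** on the local classes of `U(H)(L⁺_v)`: the
indicator `ε = 1_w ∈ L ⊗ L⁺_v = L_w × L_{c⁻¹ w}` satisfies `(c ⊗ 1)(ε)·ε = 0 = (c ⊗ 1)(1−ε)·(1−ε)` (the fibre above `v` is `{w, c⁻¹ w}`,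
★ `PlacesOver.eq_or_eq_galInv`), so §2 applies.  (`U(H)(L⁺_v) ≅ GL_N(L⁺_v)`: every centraliser is quasi-split.)
[cite: Rogawski1990, §4.1 (4.1.2) p. 39] [cite: CasselsFrohlichANT1967, Ch. VII Prop. 1.2 (ii)] -/
theorem kottwitzSignLocal_eq_one_of_smul_ne (v : HeightOneSpectrum (𝓞 ↥(maximalRealSubfield L))) (w : UnitaryGroup.PlacesOver L v)
    (hw : IsCMField.complexConj L • w.1 ≠ w.1) (c : ConjClasses ((UnitaryGroup.cmDatum L N H).Local v)) :
    kottwitzSignLocal L N H v c = 1 := by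
  classical
  set cc := IsCMField.complexConj L with hccdef
  set ε : UnitaryGroup.LocalRing L v := fun w' => if w' = w then 1 else 0 with hε
  have hgal : UnitaryGroup.PlacesOver.galInv cc w ≠ w := UnitaryGroup.PlacesOver.galInv_ne cc w hw
  have hconj : ∀ (x : UnitaryGroup.LocalRing L v) (w' : UnitaryGroup.PlacesOver L v),
      UnitaryGroup.conjLocal L cc v x w' = galAdicCompletionMap cc (smul_inv_smul cc w'.1) (x (UnitaryGroup.PlacesOver.galInv cc w')) :=
    fun x w' => rfl
  have hε1 : ∀ w', ε w' = if w' = w then 1 else 0 := fun _ => rfl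
  have h1 : UnitaryGroup.conjLocal L cc v ε * ε = 0 := by
    funext w'
    rw [Pi.mul_apply, Pi.zero_apply, hconj, hε1, hε1]
    by_cases hw' : w' = w
    · subst hw'
      rw [if_neg hgal, map_zero, zero_mul]
    · rw [if_neg hw', mul_zero]
  have h2 : UnitaryGroup.conjLocal L cc v (1 - ε) * (1 - ε) = 0 := by
    funext w'
    rw [Pi.mul_apply, Pi.zero_apply, hconj, Pi.sub_apply, Pi.sub_apply, Pi.one_apply, Pi.one_apply, hε1, hε1]
    by_cases hw' : w' = w
    · subst hw'
      rw [if_pos (rfl : w' = w'), sub_self, mul_zero]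
    · have hw'' : w' = UnitaryGroup.PlacesOver.galInv cc w :=
        (UnitaryGroup.PlacesOver.eq_or_eq_galInv cc (IsCMField.complexConj_ne_one L) w w').resolve_left hw'
      have hback : UnitaryGroup.PlacesOver.galInv cc w' = w := by
        rw [hw'']; exact UnitaryGroup.PlacesOver.galInv_galInv cc (IsCMField.complexConj_ne_one L) w
      rw [if_pos hback, sub_self, map_zero, zero_mul]
  unfold kottwitzSignLocal
  exact kottwitzSign_eq_one_of_conj_mul_self_eq_zero _ _ h1 h2 _

/-- Hence at a split place the adelic-class factor `e_v(g_v)` is `1` for EVERY `g ∈ U(H)(𝔸)`. [cite: Rogawski1990, §4.1 (4.1.2) p. 39] -/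
theorem kottwitzSignLocal_mk_toLocal_eq_one_of_smul_ne (v : HeightOneSpectrum (𝓞 ↥(maximalRealSubfield L))) (w : UnitaryGroup.PlacesOver L v)
    (hw : IsCMField.complexConj L • w.1 ≠ w.1) (g : (UnitaryGroup.cmDatum L N H).Adelic) :
    kottwitzSignLocal L N H v (ConjClasses.mk ((UnitaryGroup.cmDatum L N H).toLocal v g)) = 1 :=
  kottwitzSignLocal_eq_one_of_smul_ne L N H v w hw _

end CMSplit

end Literature.NumberTheory.Rogawski1990

end
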